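import Mathlib
import HarnessLib
import Summits.ResolutionOfSingularities.ResolutionOfSingularities.Theorems.WildQuotientsWildQuotientResolutionS1aA1Move1
import Summits.ResolutionOfSingularities.ResolutionOfSingularities.Theorems.WildQuotientsWildQuotientResolutionS1aA1Move2
import Summits.ResolutionOfSingularities.ResolutionOfSingularities.Theorems.WildQuotientsWildQuotientResolutionS1aA1Move2Node
import Summits.ResolutionOfSingularities.ResolutionOfSingularities.Theorems.WildQuotientsWildQuotientResolutionS1aA1KillLeaf

/-!
# S1a — INSTANCE I-2 (a1) CLOSED: `KillsIn 3` for the initial model of the a1 datum, and the conclusion of `ReachLowerInF(X)` for every root decoration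

[OURS · L1 W4.5c · lead-1 g13; plan-1 CHAIN v10.40 §4 ASSIGNMENT (iv) «a1_killsIn_three : KillsIn 3 ⇒ I-2 CLOSED via exists_reachLowerF_of_killsIn_datum»,
R-F15c (I-2 := MT-a1″ = (x₀:2,x₁:1;δ1) → on N(x₁): (X₀′:2,x₂:1;δ1) → on [X₀′]₂: (s₂:1,Y₂:1,s:2;δ1) = KILL), X-CERT v1 §2/§3 a1 (depth 3, 2+2+3
producer charts, all leaves killed)] — NOT statements of the manuscript; counted 0; AI-level work, weaker than expert review. Crux
stmt-ResolutionOfSingularities-17941 `CyclicQuotientFourfolds`, line `s1a-logminvertex` v13 (`stub_reachLowerInFX`).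

* ★★★ `GameFrame.GModel.a1_killsIn_three` — for the a1 datum (`X′` affine regular with `Γ(X′,⊤) ≃ k[x₀..x₃]` intertwining `g₀` with
  `σ: x₁ ↦ x₁+x₀, x₂ ↦ x₂+x₀, x₃ ↦ x₃+x₁x₂`, `char k = p`): `KillsIn 3 (GModel.initial hq h₀)` — move 1 assembled inline from ✓`a1_rootChartData` and
  ✓`exists_moveAtlas_of_node`, the node of `N(x₁)` modelled through the opaque witnesses of ✓`exists_a1NormChartModel`, then ✓`a1_move2` and
  ✓`a1_killsIn_one` (move 3 = the kill);
* ★★★ `GameFrame.GModel.exists_reachLowerF_initial_of_a1` — INSTANCE I-2 OF RECORD: for every root decoration `𝔄₀` of the initial model the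
  conclusion of `ReachLowerInF(X)` holds (✓`exists_reachLowerF_of_killsIn_datum`).
-/

set_option linter.dupNamespace false

noncomputable section

open CategoryTheory Limits AlgebraicGeometry TopologicalSpace Topology Opposite MvPolynomial
open Literature.AlgebraicGeometry.Resolution Literature.AlgebraicGeometry.RelativeSpec
open scoped LaurentPolynomial
open Summit.ResolutionOfSingularities.ResolutionOfSingularities.Theorems.WildQuotientResolution.S1
open Summit.ResolutionOfSingularities.ResolutionOfSingularities.Theorems.WildQuotientResolution.S1.NodeAtlas
open Summit.ResolutionOfSingularities.ResolutionOfSingularities.Theorems.WildQuotientResolution.S1.CoarseChart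
open Summit.ResolutionOfSingularities.ResolutionOfSingularities.Theorems.WildQuotientResolution.S1.ProducerStep
open Summit.ResolutionOfSingularities.ResolutionOfSingularities.Theorems.WildQuotientResolution.S1.NpFrame
open Summit.ResolutionOfSingularities.ResolutionOfSingularities.Theorems.WildQuotientResolution.S1.GoodCharts
open Summit.ResolutionOfSingularities.ResolutionOfSingularities.Theorems.WildQuotientResolution.S1.BlowupCharts
open Summit.ResolutionOfSingularities.ResolutionOfSingularities.Theorems.WildQuotientResolution.S1.KillableTransport
open Summit.ResolutionOfSingularities.ResolutionOfSingularities.Theorems.WildQuotientResolution.S1.KillCert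
open Summit.ResolutionOfSingularities.ResolutionOfSingularities.Theorems.WildQuotientResolution.S1.ReesBigrading
open Summit.ResolutionOfSingularities.ResolutionOfSingularities.Theorems.WildQuotientResolution.S1.NodeTransport
open Summit.ResolutionOfSingularities.ResolutionOfSingularities.Theorems.WildQuotientResolution.S1.CobordantTransport
open Summit.ResolutionOfSingularities.ResolutionOfSingularities.Theorems.WildQuotientResolution.BlowupExit
open Summit.ResolutionOfSingularities.ResolutionOfSingularities.Theorems.WildQuotientResolution.S1.KillGlue
open Summit.ResolutionOfSingularities.ResolutionOfSingularities.Theorems.WildQuotientResolution.S1.FreeModel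
open Summit.ResolutionOfSingularities.ResolutionOfSingularities.Theorems.WildQuotientResolution.S1.ModelNode

namespace Summit.ResolutionOfSingularities.ResolutionOfSingularities.Theorems.WildQuotientResolution.S1.GameFrame.GModel

variable {p : ℕ} {X' X₁ : Scheme.{0}} {q : X' ⟶ X₁} {G : Type} [Group G] {ρ : G →* Aut X'} {g₀ : G}

set_option maxHeartbeats 4000000 in
set_option synthInstance.maxHeartbeats 400000 in
/-- ★★★ **`KillsIn 3` FOR THE INITIAL MODEL OF THE a1 DATUM** (MT-a1″: three admissible moves, every depth-3 realisation carries a node atlas with empty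
formal locus). See the module docstring. [OURS · L1 W4.5c · R-F15c I-2; NOT a statement of the manuscript] -/
theorem a1_killsIn_three [Finite G] (hp : p.Prime) (hG : ∀ g : G, g ∈ Subgroup.zpowers g₀) (hg₀ : g₀ ^ p = 1)
    (hq : ∀ g : G, (ρ g).hom ≫ q = q) [IsIntegral X'] [IsLocallyNoetherian X'] [X'.IsSeparated] [IsAffine X']
    (hreg : Scheme.IsRegular X') {k' : Type} [Field k'] (φ : X₁ ⟶ Spec (.of k')) [IsSeparated φ] [IsFinite q]
    {k : Type} [Field k] [CharP k p] (σ : MvPolynomial (Fin 4) k ≃+* MvPolynomial (Fin 4) k) (hC : ∀ a : k, σ (C a) = C a)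
    (h0 : σ (X 0) = X 0) (h1 : σ (X 1) = X 1 + X 0) (h2 : σ (X 2) = X 2 + X 0) (h3 : σ (X 3) = X 3 + X 1 * X 2)
    (e : Γ(X', ⊤) ≃+* MvPolynomial (Fin 4) k)
    (hστ : ∀ t : Γ(X', ⊤), e ((ρ g₀⁻¹).hom.appLE ⊤ ⊤ (by rw [Scheme.Hom.preimage_top]) t) = σ (e t))
    (h₀ : NodeAtlas p (⟨ρ, hq⟩ : ActionOver q G) g₀) :
    KillsIn 3 (GModel.initial (p := p) (g₀ := g₀) hq h₀) := by
  classical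
  haveI : NeZero p := ⟨hp.ne_zero⟩
  have hp1 : p ≠ 1 := hp.one_lt.ne'
  -- the root chart `O = X′`
  haveI : IsAffine (⊤ : X'.Opens) := isAffineOpen_top X'
  have hAff : IsAffineHom ((⊤ : X'.Opens).ι ≫ q) := inferInstance
  have hst : ∀ g : G, (ρ g).hom ⁻¹ᵁ (⊤ : X'.Opens) = ⊤ := fun g => Scheme.Hom.preimage_top _
  let O : (GModel.initial (p := p) (g₀ := g₀) hq h₀).act.StableAffineOpens := ⟨⊤, hst, hAff⟩
  have hO : IsAffineOpen O.1 := isAffineOpen_top X'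
  haveI hsep₀ : (GModel.initial (p := p) (g₀ := g₀) hq h₀).V.IsSeparated := ‹X'.IsSeparated›
  -- `e` read on `Γ(X′, O)` (definitionally `Γ(X′, ⊤)`), kept opaque
  obtain ⟨e₀, he₀⟩ : ∃ e₀ : Γ(X', O.1) ≃+* MvPolynomial (Fin 4) k, ∀ t, e₀ t = e t := ⟨e, fun _ => rfl⟩
  have he₀s : ∀ x, e₀.symm x = e.symm x := fun x => e₀.injective (by rw [e₀.apply_symm_apply, he₀, e.apply_symm_apply])
  have hact : ∀ t : Γ(X', O.1), actOEquiv (GModel.initial hq h₀).act O g₀ t = e₀.symm (σ (e₀ t)) := fun t => by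
    apply e₀.injective
    rw [e₀.apply_symm_apply, he₀, he₀, ← hστ]
    rfl
  have hZcl : IsClosed (X'.zeroLocus (U := O.1) (Set.range (e₀.symm ∘ ![X 0, X 1] : Fin 2 → Γ(X', O.1))) ∩
      (O.1 : Set (GModel.initial (p := p) (g₀ := g₀) hq h₀).V)) :=
    (X'.zeroLocus_isClosed _).inter (by exact isClosed_univ)
  obtain ⟨𝒜, gr, e', 𝒦, d, h𝒜, he', htame, hσp, hσ, hver, hadm, -, hG𝒦, h𝒦tr, -⟩ :=
    a1_rootChartData hp hG hg₀ hq hreg σ hC h0 h1 h2 h3 h₀ O hO e₀ hact hZcl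
  letI : GradedRing 𝒜 := gr
  -- the root automorphism, kept opaque
  obtain ⟨τ₀, hτ₀⟩ : ∃ τ₀ : Γ(X', O.1) ≃+* Γ(X', O.1), τ₀ = actOEquiv (GModel.initial hq h₀).act O g₀ := ⟨_, rfl⟩
  have hact₀ : ∀ t : Γ(X', O.1), τ₀ t = e₀.symm (σ (e₀ t)) := fun t => by rw [hτ₀]; exact hact t
  have htame₀ : IsTameNode p Γ(X', O.1) 𝒜 τ₀ := by rw [hτ₀]; exact htame
  have hσp₀ : ∀ x : Γ(X', O.1), (⇑τ₀)^[p] x = x := by rw [hτ₀]; exact hσp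
  have hσ₀ : ∀ t : Γ(X', O.1), ((e' (((GModel.initial hq h₀).act.aut g₀⁻¹).hom.appLE O.1 O.1 (O.2.1 g₀⁻¹).ge t) : ↥(𝒜 0)) : Γ(X', O.1)) =
      τ₀ ((e' t : ↥(𝒜 0)) : Γ(X', O.1)) := fun t => by rw [hτ₀]; exact hσ t
  refine ⟨𝒦, d, hadm, fun M₁ hm₁ => ⟨⟨NodeAtlasData.ofNodeAtlas (p := p) (ρ := M₁.act) (g₀ := g₀) M₁.atlas⟩, ?_⟩⟩
  obtain ⟨π₁, hbl, -, hr, hcomm⟩ := hm₁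
  haveI : M₁.V.IsSeparated := isSeparated_of_datum φ M₁
  -- ### MOVE 1 on the realisation `M₁`: the norm charts and the atlas `𝔄₁`
  haveI hchar : CharP Γ(X', O.1) p := charP_of_injective_ringHom (f := e₀.symm.toRingHom) e₀.symm.injective p
  have hd : 0 < d := hver.1
  have hdp : 0 < d * p := Nat.mul_pos hd hp.pos
  have hdbar : 0 < d * (2 * p) := Nat.mul_pos hd (Nat.mul_pos two_pos hp.pos)
  have hf := a1_hf hq h₀ O e₀ 𝒜 h𝒜
  have hσJ := A1.a1_map_le σ hC h0 h1 h2 h3 e₀ τ₀ hact₀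
  have hw : ∀ i, 0 < (![2, 1] : Fin 2 → ℕ) i := fun i => by fin_cases i <;> norm_num
  have hK1 := A1.a1_isRegular e₀
  have hK1' := A1.a1_isRegularRing_quotient e₀
  have hk : 0 < 2 * p := Nat.mul_pos two_pos hp.pos
  -- the cover, kept opaque
  obtain ⟨a₀, ha₀⟩ : ∃ a : Γ(X', O.1), a = e₀.symm (X 0) ^ (d * p) := ⟨_, rfl⟩
  obtain ⟨a₁, ha₁⟩ : ∃ a : Γ(X', O.1), a = (∏ i : ZMod p, (e₀.symm (X 1) + (i.val : Γ(X', O.1)) * e₀.symm (X 0))) ^ (2 * d) := ⟨_, rfl⟩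
  obtain ⟨y, hy0, hy1⟩ : ∃ y : Fin 2 → ↥(𝒜 0), y 0 = e' a₀ ∧ y 1 = e' a₁ := ⟨![e' a₀, e' a₁], rfl, rfl⟩
  have hyval : ∀ j, (y j).1 = (![a₀, a₁] : Fin 2 → Γ(X', O.1)) j := fun j => by
    fin_cases j
    · change (y 0).1 = a₀; rw [hy0]; exact he' a₀
    · change (y 1).1 = a₁; rw [hy1]; exact he' a₁
  have hy : ∀ j, y j ∈ (traceFiltration 𝒜 (e₀.symm ∘ ![X 0, X 1]) ![2, 1]).ideal (d * (2 * p)) := fun j => by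
    rw [mem_traceFiltration_iff, hyval]
    fin_cases j
    · change a₀ ∈ _; rw [ha₀]; exact A1.a1_cover_zero_mem e₀ d
    · change a₁ ∈ _; rw [ha₁]; exact A1.a1_cover_one_mem e₀ d
  have hσy : ∀ j, τ₀ (y j).1 = (y j).1 := fun j => by
    rw [hyval]
    fin_cases j
    · change τ₀ a₀ = a₀; rw [ha₀]; exact A1.a1_cover_zero_fixed σ h0 e₀ τ₀ hact₀ d
    · change τ₀ a₁ = a₁; rw [ha₁]; exact A1.a1_cover_one_fixed σ h0 h1 e₀ τ₀ hact₀ hp1 d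
  have hrad : ∀ i : Fin 2, cobordantAlgebra.u' (e₀.symm ∘ ![X 0, X 1]) ![2, 1] i ∈
      (Ideal.span (Set.range fun j => coverElement 𝒜 (e₀.symm ∘ ![X 0, X 1]) ![2, 1] (d * (2 * p)) (y j) (hy j))).radical := by
    intro i
    have h := A1.a1_hrad e₀ (p := p) d (coverElement 𝒜 (e₀.symm ∘ ![X 0, X 1]) ![2, 1] (d * (2 * p)) (y 0) (hy 0))
      (coverElement 𝒜 (e₀.symm ∘ ![X 0, X 1]) ![2, 1] (d * (2 * p)) (y 1) (hy 1)) (by rw [coe_coverElement, hyval, ← ha₀]; rfl)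
      (by rw [coe_coverElement, hyval, ← ha₁]; rfl) i
    refine Ideal.radical_mono (Ideal.span_mono ?_) h
    exact Set.insert_subset_iff.mpr ⟨⟨0, rfl⟩, Set.singleton_subset_iff.mpr ⟨1, rfl⟩⟩
  have hH1 := A1.a1_augmentationIdeal_sigmaR_le σ hC h0 h1 h2 h3 e₀ τ₀ hact₀ hp.pos hσp₀
  have hmem0 := A1.a1_u'_zero_mem_residual σ hC h0 h1 h2 h3 e₀ τ₀ hact₀ hp.pos hσp₀
  have hz := fun j => A1.a1_residualSection_zero e₀ ![] 𝒜 hf (y j) (hy j) d rfl _ hmem0 hdp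
  have hsuppO : (((𝒦.ideal d).support : Set X')) ⊆ (O.1 : Set (GModel.initial (p := p) (g₀ := g₀) hq h₀).V) :=
    fun x _ => Set.mem_univ x
  obtain ⟨OW, hOWaff, hOWeq, E, htame', hE, hpin, 𝔄₁, hF₁⟩ := exists_moveAtlas_of_node hp.pos hG (GModel.initial hq h₀) M₁ (NodeAtlasData.ofNodeAtlas (p := p) (ρ := (⟨ρ, hq⟩ : ActionOver q G)) (g₀ := g₀) h₀) O hO
    ![] 𝒜 (e₀.symm ∘ ![X 0, X 1]) ![2, 1] hf τ₀ e' htame₀ hσp₀ hσ₀ hw hK1 hK1' hσJ 𝒦 d hG𝒦 h𝒦tr hver hsuppO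
    π₁ hbl hr hcomm hk y hy hσy hrad (cobordantAlgebra.s (e₀.symm ∘ ![X 0, X 1]) ![2, 1]) hH1 (fun _ => 1)
    (fun j => ![algebraMap _ (ChartRing 𝒜 (e₀.symm ∘ ![X 0, X 1]) ![2, 1] (d * (2 * p)) (y j) (hy j))
        (cobordantAlgebra.u' (e₀.symm ∘ ![X 0, X 1]) ![2, 1] 0 ^ (d * p)) *
      IsLocalization.Away.invSelf (coverElement 𝒜 (e₀.symm ∘ ![X 0, X 1]) ![2, 1] (d * (2 * p)) (y j) (hy j))])
    (fun j l => by fin_cases l; exact (hz j).1) (fun j l => by fin_cases l; exact (hz j).2)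
  have hWle : ∀ j, (OW j).1 ≤ π₁ ⁻¹ᵁ O.1 := fun j => by rw [hOWeq j]; exact blowupChart_le_preimage π₁ _ ⟨O.1, hO⟩ _
  -- chart 0 is killed: its residual section is `1`
  have hc0 : coverElement 𝒜 (e₀.symm ∘ ![X 0, X 1]) ![2, 1] (d * (2 * p)) (y 0) (hy 0) = cobordantAlgebra.u' (e₀.symm ∘ ![X 0, X 1]) ![2, 1] 0 ^ (d * p) := by
    refine Subtype.ext ?_
    rw [coe_coverElement, SubmonoidClass.coe_pow, cobordantAlgebra.coe_u', hyval]
    change LaurentPolynomial.C a₀ * _ = (LaurentPolynomial.C (e₀.symm (X 0)) * LaurentPolynomial.T ((2 : ℕ) : ℤ)) ^ (d * p)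
    rw [ha₀, mul_pow, map_pow, LaurentPolynomial.T_pow]
    congr 2
    push_cast
    ring
  have hunit0 : algebraMap _ (ChartRing 𝒜 (e₀.symm ∘ ![X 0, X 1]) ![2, 1] (d * (2 * p)) (y 0) (hy 0))
        (cobordantAlgebra.u' (e₀.symm ∘ ![X 0, X 1]) ![2, 1] 0 ^ (d * p)) *
      IsLocalization.Away.invSelf (coverElement 𝒜 (e₀.symm ∘ ![X 0, X 1]) ![2, 1] (d * (2 * p)) (y 0) (hy 0)) = 1 := by
    rw [← hc0]; exact IsLocalization.Away.mul_invSelf _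
  have hz0W : ∀ v ∈ (OW 0).1, v ∈ M₁.V.basicOpen
      (letI := chartNodeGradedRing ![] 𝒜 (e₀.symm ∘ ![X 0, X 1]) ![2, 1] hf (d * (2 * p)) (y 0) (hy 0); (E 0).symm ⟨_, (hz 0).1⟩) := fun v hv => by
    letI := chartNodeGradedRing ![] 𝒜 (e₀.symm ∘ ![X 0, X 1]) ![2, 1] hf (d * (2 * p)) (y 0) (hy 0)
    have h1 : (⟨_, (hz 0).1⟩ : ↥(chartNodeGrading ![] 𝒜 (e₀.symm ∘ ![X 0, X 1]) ![2, 1] hf (d * (2 * p)) (y 0) (hy 0) 0)) = 1 := Subtype.ext hunit0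
    rw [h1, map_one, Scheme.basicOpen_of_isUnit _ isUnit_one]
    exact hv
  have hF₁W : 𝔄₁.fLocus ⊆ ((OW 1).1 : Set M₁.V) := by
    intro v hv
    rcases hF₁ hv with hold | hnew
    · exact absurd (Set.mem_univ _) hold.2
    · obtain ⟨j, hvW, hvR⟩ := Set.mem_iUnion.mp hnew
      revert hvW hvR
      refine Fin.cases ?_ (fun j' => Fin.cases ?_ (fun j'' => j''.elim0) j') j
      · intro hvW hvR
        exact absurd (hz0W v hvW) (hvR 0)
      · intro hvW _
        exact hvW
  letI instN := chartNodeGradedRing ![] 𝒜 (e₀.symm ∘ ![X 0, X 1]) ![2, 1] hf (d * (2 * p)) (y 1) (hy 1)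
  have hπ' : IsBlowup π₁ ((𝒦.ideal d) ^ (2 * p)) := isBlowup_pow hbl hk.ne'
  have hverbar := CoarseChart.veroneseNormalised_mul 𝒜 _ _ hver hk
  have hJ' : ((𝒦.ideal d) ^ (2 * p)).ideal ⟨O.1, hO⟩ = ((traceFiltration 𝒜 (e₀.symm ∘ ![X 0, X 1]) ![2, 1]).ideal (d * (2 * p))).comap (e' : Γ(X', O.1) →+* ↥(𝒜 0)) := by
    rw [Scheme.IdealSheafData.ideal_pow, Pi.pow_apply, ← ReesFiltration.filtration_ideal, h𝒦tr d, hver.2 (2 * p), comap_equiv_pow]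
  have hxJ1 : e'.symm (y 1) ∈ ((𝒦.ideal d) ^ (2 * p)).ideal ⟨O.1, hO⟩ := by
    rw [hJ', Ideal.mem_comap, RingHom.coe_coe, e'.apply_symm_apply]; exact hy 1
  have hcovM : ∀ x : M₁.V, x ∈ (OW 0).1 ∨ x ∈ (OW 1).1 := by
    intro x
    have hcovW := iSup_blowupChart_eq_preimage (I := 𝒦.ideal d) (GModel.initial hq h₀).act ![] 𝒜 (e₀.symm ∘ ![X 0, X 1]) ![2, 1] hf O hO e' hπ' hverbar hJ' y hy hrad
    have hx : x ∈ ⨆ j, blowupChart π₁ ((𝒦.ideal d) ^ (2 * p)) ⟨O.1, hO⟩ (e'.symm (y j)) :=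
      (congrArg (fun U : M₁.V.Opens => x ∈ U) hcovW).mpr (Set.mem_univ _)
    obtain ⟨j, hj⟩ := Opens.mem_iSup.mp hx
    revert hj
    refine Fin.cases ?_ (fun j' => Fin.cases ?_ (fun j'' => j''.elim0) j') j
    · intro hj; exact Or.inl ((congrArg (fun U : M₁.V.Opens => x ∈ U) (hOWeq 0)).mpr hj)
    · intro hj; exact Or.inr ((congrArg (fun U : M₁.V.Opens => x ∈ U) (hOWeq 1)).mpr hj)
  -- the pin `z₀′ · π^*(y₁) = π^*(y₀)`
  have hy0val : ((y 0 : ↥(𝒜 0)) : Γ(X', O.1)) = e₀.symm (X 0) ^ (d * p) := by rw [hyval, ← ha₀]; rfl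
  have hpz : (E 1).symm ⟨_, (hz 1).1⟩ * π₁.appLE O.1 (OW 1).1 (hWle 1) (e'.symm (y 1)) = π₁.appLE O.1 (OW 1).1 (hWle 1) (e'.symm (y 0)) :=
    symm_mul_appLE_eq_of_pin π₁ O.1 (OW 1).1 (hWle 1) (chartNodeGrading ![] 𝒜 (e₀.symm ∘ ![X 0, X 1]) ![2, 1] hf (d * (2 * p)) (y 1) (hy 1)) (E 1) e' (toChartRing 𝒜 (e₀.symm ∘ ![X 0, X 1]) ![2, 1] (d * (2 * p)) (y 1) (hy 1))
      (hpin 1 (hWle 1)) ⟨_, (hz 1).1⟩ (e'.symm (y 0)) (e'.symm (y 1)) (y 0) (y 1) (e'.apply_symm_apply _) (e'.apply_symm_apply _)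
      (a1_section_pin e₀ ![] 𝒜 d (y 0) (y 1) (hy 1) hy0val)
  have htU : ∀ v ∈ (OW 1).1, v ∈ (OW 0).1 → v ∈ M₁.V.basicOpen ((E 1).symm ⟨_, (hz 1).1⟩) := fun v hvW hv0 =>
    mem_basicOpen_of_mem_blowupChart_of_mul_appLE_eq hπ' ⟨O.1, hO⟩ hxJ1 (le_of_eq (hOWeq 1)) _ hpz hvW
      ((congrArg (fun U : M₁.V.Opens => v ∈ U) (hOWeq 0)).mp hv0)
  -- ### the model of the node of `W = OW 1`, opaque
  have hx2 : e₀.symm (X 2) ∈ 𝒜 0 := by rw [h𝒜]; trivial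
  have hx3 : e₀.symm (X 3) ∈ 𝒜 0 := by rw [h𝒜]; trivial
  have hyval1 : ((y 1 : ↥(𝒜 0)) : Γ(X', O.1)) = (∏ i : ZMod p, (e₀.symm (X 1) + (i.val : Γ(X', O.1)) * e₀.symm (X 0))) ^ (2 * d) := by
    rw [hyval, ← ha₁]; rfl
  obtain ⟨hh₁, Φ₁, hhh₁, r0, r1, r2, r3, r4, r5, rh, dg0, dg2, dg1, dg3, dgs, dgη, hres⟩ :=
    A1.exists_a1NormChartModel σ hC h0 h1 h2 h3 e₀ τ₀ hact₀ hp.pos hσp₀ hσJ ![] 𝒜 hf hx2 hx3 d (y 1) hyval1 (hy 1) (hσy 1)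
  letI instP := mapGradedRing (chartNodeGrading ![] 𝒜 (e₀.symm ∘ ![X 0, X 1]) ![2, 1] hf (d * (2 * p)) (y 1) (hy 1)) Φ₁
  -- facts of the free model `P = k[x_none, x′][1/h]`
  have hv : Function.Injective (![some 0, some 2] : Fin 2 → Option (Fin 4)) := by
    intro i j hij; fin_cases i <;> fin_cases j <;> first | rfl | exact absurd hij (by decide)
  have hg : ∀ i, (fun o : Option (Fin 4) => if o = some 1 then (1 : k) else 0) ((![some 0, some 2] : Fin 2 → Option (Fin 4)) i) = 0 := by
    intro i; fin_cases i <;> exact if_neg (by decide)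
  have hu : MvPolynomial.eval (fun o : Option (Fin 4) => if o = some 1 then (1 : k) else 0) hh₁ ≠ 0 := by
    rw [hhh₁]; exact A1.a1m2_eval_h_ne_zero k p d
  haveI hcharP := charP_away_of_eval_ne_zero p hh₁ _ hu
  have hfv : (fun i => algebraMap (MvPolynomial (Option (Fin 4)) k) (Localization.Away hh₁) (X ((![some 0, some 2] : Fin 2 → Option (Fin 4)) i))) =
      ![algebraMap (MvPolynomial (Option (Fin 4)) k) (Localization.Away hh₁) (X (some 0)), algebraMap (MvPolynomial (Option (Fin 4)) k) (Localization.Away hh₁) (X (some 2))] := by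
    funext i; fin_cases i <;> rfl
  have hK1₂ := isRegular_algebraMap_X_away k hh₁ _ hv _ hg hu
  have hK1'₂ := isRegularRing_quotient_X_away k hh₁ (![some 0, some 2] : Fin 2 → Option (Fin 4))
  rw [hfv] at hK1₂ hK1'₂
  have hX1u : IsUnit (algebraMap (MvPolynomial (Option (Fin 4)) k) (Localization.Away hh₁) (X (some 1))) := by
    have hdvd : (X (some 1) : MvPolynomial (Option (Fin 4)) k) ∣ hh₁ := by
      rw [hhh₁]
      refine Dvd.dvd.trans ?_ (dvd_pow_self _ (Nat.mul_ne_zero two_ne_zero hd.ne'))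
      have hfac : (X (some 1) : MvPolynomial (Option (Fin 4)) k) = X (some 1) + C (((0 : ZMod p).val : k)) * (X (some 0) * X none) := by
        rw [ZMod.val_zero, Nat.cast_zero, C_0, zero_mul, add_zero]
      conv_lhs => rw [hfac]
      exact Finset.dvd_prod_of_mem _ (Finset.mem_univ (0 : ZMod p))
    exact isUnit_of_dvd_unit (map_dvd _ hdvd) (IsLocalization.Away.algebraMap_isUnit hh₁)
  have hηη : algebraMap (MvPolynomial (Option (Fin 4)) k) (Localization.Away hh₁) hh₁ * IsLocalization.Away.invSelf hh₁ = 1 := IsLocalization.Away.mul_invSelf hh₁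
  have ht : Φ₁ (((E 1) ((E 1).symm ⟨_, (hz 1).1⟩) : ↥(chartNodeGrading ![] 𝒜 (e₀.symm ∘ ![X 0, X 1]) ![2, 1] hf (d * (2 * p)) (y 1) (hy 1) 0)) :
      ChartRing 𝒜 (e₀.symm ∘ ![X 0, X 1]) ![2, 1] (d * (2 * p)) (y 1) (hy 1)) =
      algebraMap (MvPolynomial (Option (Fin 4)) k) (Localization.Away hh₁) (X (some 0)) ^ (d * p) * IsLocalization.Away.invSelf hh₁ := by
    rw [(E 1).apply_symm_apply]; exact hres (d * p)
  -- ### move 2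
  obtain ⟨𝒦₂, d₂, hd₂, hadm₂, hmove₂⟩ := a1_move2 hp hG M₁ (OW 1)
    ({ affine := hOWaff 1, m := 0 + 1, r := Fin.cons 0 ![], B := ChartRing 𝒜 (e₀.symm ∘ ![X 0, X 1]) ![2, 1] (d * (2 * p)) (y 1) (hy 1),
       𝒜 := chartNodeGrading ![] 𝒜 (e₀.symm ∘ ![X 0, X 1]) ![2, 1] hf (d * (2 * p)) (y 1) (hy 1),
       σ := sigmaChart 𝒜 (e₀.symm ∘ ![X 0, X 1]) ![2, 1] (d * (2 * p)) (y 1) (hy 1) τ₀ hσJ hp.pos hσp₀ (hσy 1),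
       e := E 1, tame := htame' 1, intertwine := hE 1 } : NodeData p M₁.act g₀ (OW 1))
    Φ₁ (conj Φ₁ (sigmaChart 𝒜 (e₀.symm ∘ ![X 0, X 1]) ![2, 1] (d * (2 * p)) (y 1) (hy 1) τ₀ hσJ hp.pos hσp₀ (hσy 1))) (fun _ => rfl)
    (algebraMap (MvPolynomial (Option (Fin 4)) k) (Localization.Away hh₁) (X none)) (algebraMap (MvPolynomial (Option (Fin 4)) k) (Localization.Away hh₁) (X (some 0)))
    (algebraMap (MvPolynomial (Option (Fin 4)) k) (Localization.Away hh₁) (X (some 1))) (algebraMap (MvPolynomial (Option (Fin 4)) k) (Localization.Away hh₁) (X (some 2)))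
    (algebraMap (MvPolynomial (Option (Fin 4)) k) (Localization.Away hh₁) (X (some 3))) (algebraMap (MvPolynomial (Option (Fin 4)) k) (Localization.Away hh₁) hh₁)
    (IsLocalization.Away.invSelf hh₁) _ r0 r1 r2 r3 r4 (r5 _ (Set.mem_union_left _ (Set.mem_singleton _))) hηη r5 (A1.a1_model_closure_eq_top hh₁) hX1u
    (consIndexEquiv ![] ((1 : ℤ), 0)) d hd dg0 dg2 dgs dgη hK1₂ hK1'₂ (OW 0).1 (fun x => (hcovM x).symm) _ ht htU 𝔄₁ hF₁W
  refine ⟨𝒦₂, d₂, hadm₂, fun M₂ hm₂ => ⟨⟨NodeAtlasData.ofNodeAtlas (p := p) (ρ := M₂.act) (g₀ := g₀) M₂.atlas⟩, ?_⟩⟩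
  obtain ⟨π₂, hbl₂, -, hr₂, hcomm₂⟩ := hm₂
  haveI : M₂.V.IsSeparated := isSeparated_of_datum φ M₂
  obtain ⟨W₂, 𝔄₂, hF₂, hW₂aff, hle, hf₂, hσJ₂, hσp₂, y₀, hy₀v, hy₀, hσy₀, c₁, hc₁, E₂, W₂', u₂, htame₂, hE₂, hpin₂, hcov₂, hu₂v, hu₂U⟩ :=
    hmove₂ M₂ π₂ hbl₂ hr₂ hcomm₂
  -- ### move 3 = the kill
  have hu₁U : ∀ v ∈ W₂.1, v ∈ π₂ ⁻¹ᵁ (OW 0).1 → v ∈ M₂.V.basicOpen (π₂.appLE (OW 1).1 W₂.1 hle ((E 1).symm ⟨_, (hz 1).1⟩)) := by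
    intro v hvW hvU
    rw [Scheme.basicOpen_appLE]
    exact ⟨hvW, htU (π₂.base v) (hle hvW) hvU⟩
  exact a1_killsIn_one hp hG M₂ hh₁ d hd hhh₁ _ _ _ _ _ _ rfl rfl rfl rfl rfl rfl
    (mapGrading (chartNodeGrading ![] 𝒜 (e₀.symm ∘ ![X 0, X 1]) ![2, 1] hf (d * (2 * p)) (y 1) (hy 1)) Φ₁) (consIndexEquiv ![] ((1 : ℤ), 0))
    (conj Φ₁ (sigmaChart 𝒜 (e₀.symm ∘ ![X 0, X 1]) ![2, 1] (d * (2 * p)) (y 1) (hy 1) τ₀ hσJ hp.pos hσp₀ (hσy 1)))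
    r0 r1 r2 r3 r4 r5 rh hσp₂ dg0 dg1 dg3 dgs dgη d₂ hd₂ W₂ hW₂aff hf₂ hσJ₂ y₀ hy₀v hy₀ hσy₀ c₁ hc₁ E₂ htame₂ hE₂
    W₂' (π₂ ⁻¹ᵁ (OW 0).1) (fun x => hcov₂ x) u₂ hu₂v hu₂U (π₂.appLE (OW 1).1 W₂.1 hle ((E 1).symm ⟨_, (hz 1).1⟩)) _ ht (hpin₂ _) hu₁U 𝔄₂ hF₂

/-- ★★★ **INSTANCE I-2 OF RECORD (a1 = MT-a1″)**: for the a1 datum and EVERY node atlas `𝔄₀` on the initial model there is a class `P ∋ (M₀, 𝔄₀)` of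
decorated models from every non-terminal member of which a bounded `TreeF` inside `P` reaches `μ_F`-lower decorated models — the conclusion of
`ReachLowerInF(X)` at `(M₀, 𝔄₀)`. [OURS · L1 W4.5c · R-F15c I-2; NOT a statement of the manuscript] -/
theorem exists_reachLowerF_initial_of_a1 [Finite G] (hp : p.Prime) (hG : ∀ g : G, g ∈ Subgroup.zpowers g₀) (hg₀ : g₀ ^ p = 1)
    (hq : ∀ g : G, (ρ g).hom ≫ q = q) [IsIntegral X'] [IsLocallyNoetherian X'] [X'.IsSeparated] [IsAffine X']
    (hreg : Scheme.IsRegular X') {k' : Type} [Field k'] (φ : X₁ ⟶ Spec (.of k')) [IsSeparated φ] [LocallyOfFiniteType φ] [IsFinite q]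
    {k : Type} [Field k] [CharP k p] (σ : MvPolynomial (Fin 4) k ≃+* MvPolynomial (Fin 4) k) (hC : ∀ a : k, σ (C a) = C a)
    (h0 : σ (X 0) = X 0) (h1 : σ (X 1) = X 1 + X 0) (h2 : σ (X 2) = X 2 + X 0) (h3 : σ (X 3) = X 3 + X 1 * X 2)
    (e : Γ(X', ⊤) ≃+* MvPolynomial (Fin 4) k)
    (hστ : ∀ t : Γ(X', ⊤), e ((ρ g₀⁻¹).hom.appLE ⊤ ⊤ (by rw [Scheme.Hom.preimage_top]) t) = σ (e t))
    (h₀ : NodeAtlas p (⟨ρ, hq⟩ : ActionOver q G) g₀) (𝔄₀ : NodeAtlasData p (GModel.initial hq h₀).act g₀) :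
    ∃ P : ∀ M : GModel p q G ρ g₀, NodeAtlasData p M.act g₀ → Prop,
      P (GModel.initial hq h₀) 𝔄₀ ∧ ∀ (M : GModel p q G ρ g₀) (𝔄 : NodeAtlasData p M.act g₀), P M 𝔄 → ¬ M.Terminal →
        ∃ n : ℕ, TreeF P (fun N 𝔅 => LexLTF N 𝔅 M 𝔄) n M 𝔄 :=
  exists_reachLowerF_of_killsIn_datum hp hG φ (GModel.initial hq h₀) 𝔄₀ (a1_killsIn_three hp hG hg₀ hq hreg φ σ hC h0 h1 h2 h3 e hστ h₀)

end Summit.ResolutionOfSingularities.ResolutionOfSingularities.Theorems.WildQuotientResolution.S1.GameFrame.GModel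

end
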